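import Summits.BirchSwinnertonDyer.BirchSwinnertonDyer.Theorems.KolyvaginRankRigidityAtTwoSwapAuxClassLocalAtTwo
import Summits.BirchSwinnertonDyer.BirchSwinnertonDyer.Theorems.KolyvaginRankRigidityAtTwoSwapPairingUpperBoundAtTwo
import HarnessLib

/-!
# Crux V2♭θ `KolyvaginCorankLowerBoundAtTwoTheta` (stmt-BirchSwinnertonDyer-27220), line
# `kolyvagin_depth_split`, inside of S1, piece **P7b** — second form: the upper bound of the pairing order
# at the swapped-out prime from DISJOINTNESS `Kum_v ∩ 𝒯_v = 0` and the COUNT `#H ≤ #Kum_v · #𝒯_v`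
# instead of the purity of `𝒯_v` (helper, PROVED; seat `bsd-line-krr2-p2` g7)

`pow_smul_localTatePairingZMod_eq_zero_of_transverse` (this seat, `…SwapPairingUpperBoundAtTwo`) discharges the
hypothesis `hP7b` of the lead's S1 composition (`c₇' = 0`) from (iso) + (pure) for the transverse condition
`𝒯_v`.  For the ring-class transverse family the tree PROVES (iso) (lead's
`dualTransported_eq_of_localTransverseFamily_two`), DISJOINTNESS from the Kummer condition
(`JET.Walk.disjoint_kummer_iInf_transverseSubgroup`, any `p`) and the COUNT `#𝒯_v = #E(K_v)[2^M]`
(`JET.RingClassTransverse.natCard_transverseSubgroup_ringClassField_eq`, any `p`), but not purity.  This file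
gives the bound from (iso) + (disj) + (count), so that `hP7b` becomes dischargeable with what the tree has:
`pow_smul_localTatePairingZMod_eq_zero_of_isCompl`.  Mechanism: `H = Kum_v ⊕ 𝒯_v` (disjoint of
complementary size), `Kum_v ≅ E[2^M](K̄)` is `2^M`-HOMOGENEOUS (divisibility of `E(K̄)`, seat g6's evaluation
equivalence), and seat g6's abstract `SwapPairing.pow_smul_pairing_eq_zero_of_split`.
HONEST FRAMING: helper (`--supports` 27220); S1 / V2♭θ are NOT proved; BSD is not proved by any of this.

References: [cite: Kolyvagin1991MathAnn, §2 (proof of Thm. 2.2)] [cite: McCallumLMS1991, §4, §5 Prop. 5.2]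
[cite: Jetchev2008, §4.2 (p. 818)] [cite: MazurRubin2004, Lemma 1.2.4] [cite: SilvermanAEC2009, Prop. III.2.5 (divisibility)].
-/

set_option autoImplicit false
set_option linter.dupNamespace false

noncomputable section

open scoped Classical
open Function NumberField IsDedekindDomain WeierstrassCurve Field
open Literature.NumberTheory.EllipticCurves Literature.NumberTheory.GaloisRepresentations
open Literature.NumberTheory.GaloisCohomology
open Literature.NumberTheory.GaloisRepresentations.DiscreteGaloisModule (localTatePairingZMod tateDual
  SelmerStructure)
open Summit.BirchSwinnertonDyer.Rank1Residual
open Summit.BirchSwinnertonDyer.Rank1Residual.JET.GlobalDuality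

namespace Summit.BirchSwinnertonDyer.BirchSwinnertonDyer.Theorems.KolyvaginLowerBoundAtTwo

variable {K : Type} [Field K] [NumberField K] (W : WeierstrassCurve ℚ) [W.IsElliptic]
  [W.IsGloballyMinimal] [(W.baseChange K).IsElliptic]
  (M : ℕ) [NeZero (2 ^ M)] [Finite (geomTorsion (W.baseChange K) ((2 ^ M : ℕ) : ℤ))]
  (e : geomTorsion (W.baseChange K) ((2 ^ M : ℕ) : ℤ) → geomTorsion (W.baseChange K) ((2 ^ M : ℕ) : ℤ) →
    AlgebraicClosure K)
  (hμ : ∀ S T, e S T ^ (2 ^ M) = 1)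
  (hadd₁ : ∀ S₁ S₂ T, e (S₁ + S₂) T = e S₁ T * e S₂ T)
  (hadd₂ : ∀ S T₁ T₂, e S (T₁ + T₂) = e S T₁ * e S T₂)
  (hgal : ∀ (g : absoluteGaloisGroup K) (S T : geomTorsion (W.baseChange K) ((2 ^ M : ℕ) : ℤ)),
    g • e S T = e (g • S) (g • T))
  (inv : LocalInvariants K (2 ^ M))
  (𝒯 : SelmerStructure ((W.baseChange K).torsionGaloisModule ((2 ^ M : ℕ) : ℤ)))

omit [NeZero (2 ^ M)] in
/-- **`Kum_v` is `2^M`-homogeneous at a Zhang–Kolyvagin place of index `≥ M`**: a Kummer class killed by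
`2^a` (`a ≤ M`) is `2^{M-a}` times a Kummer class — `Kum_v ≅ E[2^M](K̄)` as a group (seat g6's evaluation
equivalence, `Kum_v = H¹_ur`, trivial local action) and `E(K̄)` is divisible.
[cite: SilvermanAEC2009, Prop. III.2.5 and §VIII.2] [cite: Jetchev2008, §3.2 (2)] -/
theorem kummer_homogeneous_at_two (hK : IsImaginaryQuadratic K) {ℓ : ℕ}
    (hℓ : Zhang2014.IsKolyvaginPrime (W.conductorNorm ℤ) W K 2 ℓ) (hMℓ : M ≤ Zhang2014.kolyvaginIndex W 2 ℓ)
    (v : HeightOneSpectrum (𝓞 K)) (hv : ((ℓ : ℕ) : 𝓞 K) ∈ v.asIdeal)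
    {k : galoisCohomology (((W.baseChange K).torsionGaloisModule ((2 ^ M : ℕ) : ℤ)).toLocal (Sum.inr v : Place K)) 1}
    (hk : k ∈ (W.baseChange K).kummerSelmerStructure ((2 ^ M : ℕ) : ℤ) (Sum.inr v : Place K))
    {a : ℕ} (ha : a ≤ M) (hka : (2 : ℤ) ^ a • k = 0) :
    ∃ k' ∈ (W.baseChange K).kummerSelmerStructure ((2 ^ M : ℕ) : ℤ) (Sum.inr v : Place K),
      k = (2 : ℤ) ^ (M - a) • k' := by
  classical
  haveI : Fact (Nat.Prime 2) := ⟨Nat.prime_two⟩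
  haveI : CharZero (v.adicCompletion K) :=
    charZero_of_injective_algebraMap (algebraMap K (v.adicCompletion K)).injective
  have e2 : ∀ n : ℕ, ((2 ^ n : ℕ) : ℤ) = (2 : ℤ) ^ n := fun n ↦ by norm_num
  -- `Kum_v = H¹_ur ≃+ E[2^M](K̄)`
  obtain ⟨hgood, hpv⟩ := hasGoodReductionAt_of_zhangKolyvaginPrime W K hℓ v hv 1
  have hpv' : ((2 : ℕ) : 𝓞 K) ∉ v.asIdeal := by rwa [pow_one, Int.cast_natCast] at hpv
  have hKumEq : (W.baseChange K).kummerSelmerStructure ((2 ^ M : ℕ) : ℤ) (Sum.inr v : Place K) =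
      DiscreteGaloisModule.unramifiedSubgroup (GaloisRep.toLocal v
        ((W.baseChange K).torsionGaloisModule ((2 ^ M : ℕ) : ℤ))) 1 := by
    rw [X11b.KummerPT.kummerSelmerStructure_inr_eq_unramifiedSubgroup (W.baseChange K) 2 M hpv' hgood]
  obtain ⟨φ, hφ⟩ := exists_isAbsArithFrob_holds (v.adicCompletion K)
  have hφ1 : IsFrobPow φ 1 := IsAbsArithFrob.isFrobPow_holds hφ
  obtain ⟨eK, -, -⟩ := exists_addEquiv_unramified_eval (GaloisRep.toLocal v
      ((W.baseChange K).torsionGaloisModule ((2 ^ M : ℕ) : ℤ)))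
    (galoisRep_toLocal_apply_eq_self W K hK hℓ hMℓ v hv) hφ1
    (AddMonoidHom.id _) (AddMonoidHom.id _) id (fun ψ => ⟨ψ, rfl, fun _ => rfl⟩) hφ1 (fun _ h => h)
  have eK' : ((W.baseChange K).kummerSelmerStructure ((2 ^ M : ℕ) : ℤ) (Sum.inr v : Place K)) ≃+
      geomTorsion (W.baseChange K) ((2 ^ M : ℕ) : ℤ) := (AddEquiv.addSubgroupCongr hKumEq).trans eK
  -- `P = eK' k` is killed by `2^a`; divisibility gives `Q` with `2^(M-a) Q = P`, and `Q ∈ E[2^M]`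
  set ksub : (W.baseChange K).kummerSelmerStructure ((2 ^ M : ℕ) : ℤ) (Sum.inr v : Place K) := ⟨k, hk⟩ with hksub
  have hkord : addOrderOf (eK' ksub) ∣ 2 ^ a := by
    rw [AddEquiv.addOrderOf_eq, ← AddSubgroup.addOrderOf_coe]
    exact addOrderOf_dvd_of_nsmul_eq_zero
      ((natCast_zsmul k (2 ^ a)).symm.trans ((congrArg (fun z : ℤ => z • k) (e2 a)).trans hka))
  have hPa : (2 ^ a) • ((eK' ksub : geomTorsion (W.baseChange K) ((2 ^ M : ℕ) : ℤ)) : geomPoints (W.baseChange K)) = 0 := by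
    rw [← addOrderOf_dvd_iff_nsmul_eq_zero, AddSubgroup.addOrderOf_coe]
    exact hkord
  have hn0 : ((2 : ℤ) ^ (M - a)) ≠ 0 := pow_ne_zero _ two_ne_zero
  obtain ⟨Q, hQ⟩ := (W.baseChange K).zsmul_geomPoints_surjective_of_charZero hn0
    ((eK' ksub : geomTorsion (W.baseChange K) ((2 ^ M : ℕ) : ℤ)) : geomPoints (W.baseChange K))
  simp only at hQ
  have hQM : Q ∈ geomTorsion (W.baseChange K) ((2 ^ M : ℕ) : ℤ) := by
    rw [mem_geomTorsion_iff]
    calc ((2 ^ M : ℕ) : ℤ) • Q = ((2 : ℤ) ^ a * (2 : ℤ) ^ (M - a)) • Q := by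
          rw [← pow_add, Nat.add_sub_cancel' ha, e2]
      _ = (2 : ℤ) ^ a • ((eK' ksub : geomTorsion (W.baseChange K) ((2 ^ M : ℕ) : ℤ)) :
            geomPoints (W.baseChange K)) := by rw [mul_smul, hQ]
      _ = 0 := by rw [← e2, natCast_zsmul]; exact hPa
  -- `k' := eK'⁻¹ Q`
  set k'sub := eK'.symm ⟨Q, hQM⟩ with hk'sub
  refine ⟨(k'sub : _), k'sub.2, ?_⟩
  -- `eK' (2^(M-a) • k'sub) = 2^(M-a) • Q = P = eK' ksub`
  have heq : ksub = (2 : ℤ) ^ (M - a) • k'sub := by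
    apply eK'.injective
    rw [map_zsmul, hk'sub, AddEquiv.apply_symm_apply]
    apply Subtype.ext
    rw [AddSubgroup.coe_zsmul]
    exact hQ.symm
  have h := congrArg Subtype.val heq
  rw [AddSubgroup.coe_zsmul] at h
  exact h

/-- **P7b from DISJOINTNESS and the COUNT (constant `0`).**  At the place `v` of a Zhang–Kolyvagin prime `ℓ` of
index `≥ M`, for a local condition `T = 𝒯_v` that is self-dual under the Weil transport (`h𝒯sd` at `v`),
DISJOINT from `Kum_v` and with `#H¹(K_v, E[2^M]) ≤ #Kum_v · #T`: for global classes `w`, `C` with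
`loc_v C ∈ T`, `2^{a₀} loc_v w ∈ T`, `2^{b₀} loc_v C = 0`, the local pairing satisfies
`2^{a₀+b₀−M} · ⟨loc_v w, loc_v (w_* C)⟩_v = 0` — the hypothesis `hP7b` of the lead's `primeSwapAtTwoLossy_core`
with `c₇' = 0`.  (`H = Kum_v ⊕ T`, `Kum_v` homogeneous, seat g6's `SwapPairing.pow_smul_pairing_eq_zero_of_split`.)
[cite: Kolyvagin1991MathAnn, §2 (proof of Thm. 2.2)] [cite: McCallumLMS1991, §5 Prop. 5.2]
[cite: Jetchev2008, §4.2 (p. 818)] -/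
theorem pow_smul_localTatePairingZMod_eq_zero_of_disjoint (hK : IsImaginaryQuadratic K) {ℓ : ℕ}
    (hℓ : Zhang2014.IsKolyvaginPrime (W.conductorNorm ℤ) W K 2 ℓ) (hMℓ : M ≤ Zhang2014.kolyvaginIndex W 2 ℓ)
    (v : HeightOneSpectrum (𝓞 K)) (hv : ((ℓ : ℕ) : 𝓞 K) ∈ v.asIdeal)
    (h𝒯sd : inv.dualTransported 𝒯
      (weilDualIntertwining (W.baseChange K) (2 ^ M) e hμ hadd₁ hadd₂ hgal) (Sum.inr v) = 𝒯 (Sum.inr v))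
    (hdisj : Disjoint ((W.baseChange K).kummerSelmerStructure ((2 ^ M : ℕ) : ℤ) (Sum.inr v : Place K)) (𝒯 (Sum.inr v)))
    (hcard : Nat.card (galoisCohomology (((W.baseChange K).torsionGaloisModule ((2 ^ M : ℕ) : ℤ)).toLocal (Sum.inr v : Place K)) 1) ≤
      Nat.card ((W.baseChange K).kummerSelmerStructure ((2 ^ M : ℕ) : ℤ) (Sum.inr v : Place K)) * Nat.card (𝒯 (Sum.inr v)))
    (w C : galoisCohomology ((W.baseChange K).torsionGaloisModule ((2 ^ M : ℕ) : ℤ)) 1) {a₀ b₀ : ℕ}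
    (hCT : galoisCohomology.localization ((W.baseChange K).torsionGaloisModule ((2 ^ M : ℕ) : ℤ)) (Sum.inr v) 1 C ∈ 𝒯 (Sum.inr v))
    (hwT : ((2 ^ a₀ : ℕ) : ℤ) • galoisCohomology.localization ((W.baseChange K).torsionGaloisModule ((2 ^ M : ℕ) : ℤ)) (Sum.inr v) 1 w ∈ 𝒯 (Sum.inr v))
    (hC0 : ((2 ^ b₀ : ℕ) : ℤ) • galoisCohomology.localization ((W.baseChange K).torsionGaloisModule ((2 ^ M : ℕ) : ℤ)) (Sum.inr v) 1 C = 0) :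
    (2 ^ (a₀ + b₀ - M) : ℕ) •
        localTatePairingZMod ((W.baseChange K).torsionGaloisModule ((2 ^ M : ℕ) : ℤ)) (2 ^ M) (Sum.inr v) (inv (Sum.inr v))
          (galoisCohomology.localization ((W.baseChange K).torsionGaloisModule ((2 ^ M : ℕ) : ℤ)) (Sum.inr v) 1 w)
          (galoisCohomology.localization (((W.baseChange K).torsionGaloisModule ((2 ^ M : ℕ) : ℤ)).tateDual (2 ^ M)) (Sum.inr v) 1
            (galoisCohomology.map
              (weilDualIntertwining (W.baseChange K) (2 ^ M) e hμ hadd₁ hadd₂ hgal) 1 C)) = 0 := by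
  classical
  haveI : Finite (galoisCohomology (((W.baseChange K).torsionGaloisModule ((2 ^ M : ℕ) : ℤ)).toLocal (Sum.inr v : Place K)) 1) :=
    finite_galoisCohomology_one_toLocal _ v
  have e2 : ∀ n : ℕ, ((2 ^ n : ℕ) : ℤ) = (2 : ℤ) ^ n := fun n ↦ by norm_num
  set b : galoisCohomology (((W.baseChange K).torsionGaloisModule ((2 ^ M : ℕ) : ℤ)).toLocal (Sum.inr v : Place K)) 1 →+
      galoisCohomology (((W.baseChange K).torsionGaloisModule ((2 ^ M : ℕ) : ℤ)).toLocal (Sum.inr v : Place K)) 1 →+ ZMod (2 ^ M) :=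
    (localTatePairingZMod ((W.baseChange K).torsionGaloisModule ((2 ^ M : ℕ) : ℤ)) (2 ^ M) (Sum.inr v : Place K) (inv (Sum.inr v))).compl₂
      (galoisCohomology.map ((weilDualIntertwining (W.baseChange K) (2 ^ M) e hμ hadd₁ hadd₂ hgal).restrictField
        (v.adicCompletion K)) 1) with hb
  -- `Kum ⊔ T = ⊤`
  have hinf : (((W.baseChange K).kummerSelmerStructure ((2 ^ M : ℕ) : ℤ) (Sum.inr v : Place K)) ⊓ 𝒯 (Sum.inr v)) = ⊥ := hdisj.eq_bot
  have hsup : (((W.baseChange K).kummerSelmerStructure ((2 ^ M : ℕ) : ℤ) (Sum.inr v : Place K)) ⊔ 𝒯 (Sum.inr v)) = ⊤ := by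
    have h := LagrangianSign.card_sup_mul_card_inf ((W.baseChange K).kummerSelmerStructure ((2 ^ M : ℕ) : ℤ) (Sum.inr v : Place K)) (𝒯 (Sum.inr v))
    rw [hinf, AddSubgroup.card_bot, mul_one] at h
    apply AddSubgroup.eq_top_of_card_eq
    refine le_antisymm (Nat.card_le_card_of_injective _ Subtype.val_injective) ?_
    rw [h]; exact hcard
  have hKT : ∀ x : galoisCohomology (((W.baseChange K).torsionGaloisModule ((2 ^ M : ℕ) : ℤ)).toLocal (Sum.inr v : Place K)) 1,
      ∃ k ∈ ((W.baseChange K).kummerSelmerStructure ((2 ^ M : ℕ) : ℤ) (Sum.inr v : Place K)), ∃ t ∈ 𝒯 (Sum.inr v), x = k + t := fun x => by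
    obtain ⟨k, hk, t, ht, hx⟩ := AddSubgroup.mem_sup.mp (show x ∈ ((W.baseChange K).kummerSelmerStructure ((2 ^ M : ℕ) : ℤ) (Sum.inr v : Place K)) ⊔ 𝒯 (Sum.inr v) by rw [hsup]; trivial)
    exact ⟨k, hk, t, ht, hx.symm⟩
  have hdisj' : ∀ x ∈ ((W.baseChange K).kummerSelmerStructure ((2 ^ M : ℕ) : ℤ) (Sum.inr v : Place K)), x ∈ 𝒯 (Sum.inr v) → x = 0 := fun x hx hx' =>
    (AddSubgroup.mem_bot).mp (hinf ▸ AddSubgroup.mem_inf.mpr ⟨hx, hx'⟩)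
  have hhom : ∀ k ∈ ((W.baseChange K).kummerSelmerStructure ((2 ^ M : ℕ) : ℤ) (Sum.inr v : Place K)), ∀ a : ℕ, a ≤ M → (2 : ℤ) ^ a • k = 0 → ∃ k' ∈ ((W.baseChange K).kummerSelmerStructure ((2 ^ M : ℕ) : ℤ) (Sum.inr v : Place K)), k = (2 : ℤ) ^ (M - a) • k' :=
    fun k hk a ha hka => kummer_homogeneous_at_two W M hK hℓ hMℓ v hv hk ha hka
  have hTy : ∀ t ∈ 𝒯 (Sum.inr v), b t (galoisCohomology.localization ((W.baseChange K).torsionGaloisModule ((2 ^ M : ℕ) : ℤ)) (Sum.inr v) 1 C) = 0 := fun t ht =>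
    localTatePairingZMod_localMap_eq_zero_of_selfDual W M e hμ hadd₁ hadd₂ hgal inv 𝒯 (Sum.inr v) h𝒯sd ht hCT
  have hKy : ∀ k ∈ ((W.baseChange K).kummerSelmerStructure ((2 ^ M : ℕ) : ℤ) (Sum.inr v : Place K)), (2 : ℤ) ^ b₀ • b k (galoisCohomology.localization ((W.baseChange K).torsionGaloisModule ((2 ^ M : ℕ) : ℤ)) (Sum.inr v) 1 C) = 0 := by
    intro k _
    rw [← map_zsmul, ← e2, hC0, map_zero]
  have ha' : (2 : ℤ) ^ a₀ • galoisCohomology.localization ((W.baseChange K).torsionGaloisModule ((2 ^ M : ℕ) : ℤ)) (Sum.inr v) 1 w ∈ 𝒯 (Sum.inr v) := by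
    rw [← e2]; exact hwT
  have key := SwapPairing.pow_smul_pairing_eq_zero_of_split (M := M) b ((W.baseChange K).kummerSelmerStructure ((2 ^ M : ℕ) : ℤ) (Sum.inr v : Place K)) (𝒯 (Sum.inr v)) hKT hdisj' hhom hTy hKy ha'
  have hnat : galoisCohomology.localization (((W.baseChange K).torsionGaloisModule ((2 ^ M : ℕ) : ℤ)).tateDual (2 ^ M)) (Sum.inr v : Place K) 1
      (galoisCohomology.map (weilDualIntertwining (W.baseChange K) (2 ^ M) e hμ hadd₁ hadd₂ hgal) 1 C) =
      galoisCohomology.map ((weilDualIntertwining (W.baseChange K) (2 ^ M) e hμ hadd₁ hadd₂ hgal).restrictField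
        (v.adicCompletion K)) 1 (galoisCohomology.localization ((W.baseChange K).torsionGaloisModule ((2 ^ M : ℕ) : ℤ)) (Sum.inr v) 1 C) :=
    galoisCohomology.res_map_one _ _ C
  rw [hnat, ← natCast_zsmul, e2]
  exact key

end Summit.BirchSwinnertonDyer.BirchSwinnertonDyer.Theorems.KolyvaginLowerBoundAtTwo

end
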